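import Mathlib
import HarnessLib
import Summits.NavierStokesRegularity.NavierStokesRegularity.Theorems.LocalSineTubeDoorLocalPointZoomGradSlices
import Summits.NavierStokesRegularity.NavierStokesRegularity.Theorems.LocalSineTubeDoorWindowFatou

/-!
# The one-window door family — window Fatou lemma, SEQUENCE form (fading only along the zoom's own time sequence)

Cell ns-regularity-ideate, seat p6 (route-directed support for nsreg-p1's door family; anchor
`--supports stmt-NavierStokesRegularity-20017`).  `…WindowFatou.windowFatou_firstOrder` (p441712) takes the fading of the
window scalar along the full filter `t → T⁻`; its proof only uses the fading along the zoom's own time sequence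
`tⱼ = T + λⱼ² s/ν` at the slice `s`.  This file records that SEQUENCE form (same proof, the composition with `t → T⁻`
removed), which is what the MOST-TIMES door template (`…MostTimesGenericDoor`) needs: there the fading is only known
along times outside an exceptional set, and along the zoom sequence only for almost every slice `s`.

* `windowFatou_firstOrder_seq` — for `s < 0` with all `tⱼ = T + λⱼ² s/ν ∈ [0,T)`: if
  `∫_U |F(√(T−tⱼ) u(tⱼ, x₀+√(T−tⱼ)y), (T−tⱼ) ∇u(tⱼ, x₀+√(T−tⱼ)y))| dy → 0` along `j`, then for every `y ∈ U`,
  `F(σν • v(s, σy), σ²ν • Dv(s)(σy)) = 0` (`σ = √(−s)/√ν`).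

WHAT THIS IS NOT: not a claim about Navier–Stokes regularity; measure-theoretic glue for door routes (bears_on
LADDER-NS N0).
-/

noncomputable section

-- the summit and its single sub-problem share the name (CONVENTIONS §1), as in every Theorems file
set_option linter.dupNamespace false

namespace Summit.NavierStokesRegularity.NavierStokesRegularity.Theorems.LocalSineTubeDoorWindowFatouSeq

open MeasureTheory Set Function Filter Topology TopologicalSpace Metric
open scoped RealInnerProductSpace InnerProductSpace NNReal ENNReal
open Literature.Analysis Literature.Analysis.FluidPDE
open Summit.NavierStokesRegularity.NavierStokesRegularity.Theorems.LocalSineTubeDoorProfileAlignedWindowRigidityAncient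

/-- **Generic window glue (Fatou on one window), SEQUENCE form.**  As `…WindowFatou.windowFatou_firstOrder`, with the
fading hypothesis only along the zoom's own times `tⱼ = T + λⱼ² s/ν` at the slice `s` (all in `[0,T)`). -/
theorem windowFatou_firstOrder_seq {ν T : ℝ} (hν : 0 < ν)
    {u : ℝ → EuclideanSpace ℝ (Fin 3) → EuclideanSpace ℝ (Fin 3)} {p : ℝ → EuclideanSpace ℝ (Fin 3) → ℝ}
    (hcl : IsClassicalNSSolutionOn (Ico 0 T) ν 0 u p) {x₀ : EuclideanSpace ℝ (Fin 3)}
    {C : ℝ} {v : ℝ → EuclideanSpace ℝ (Fin 3) → EuclideanSpace ℝ (Fin 3)} {lam : ℕ → ℝ}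
    (hlam : ∀ j, 0 < lam j) (hlam0 : Tendsto lam atTop (𝓝 0))
    (hrate : HasTypeITimeDecay C v) (hcont : ContinuousOn (uncurry v) (Iio (0 : ℝ) ×ˢ univ))
    (hmild : ∀ s t : ℝ, s < t → t < 0 → ∀ x,
      v t x = UnboundedOperators.heatExtension (v s) (t - s) x - oseenDuhamel 1 s v v t x)
    (hconv : ∀ s < 0, ∀ y,
      Tendsto (fun j => (lam j / ν) • u (T + lam j ^ 2 * s / ν) (x₀ + lam j • y)) atTop (𝓝 (v s y)) ∧
      Tendsto (fun j => (lam j ^ 2 / ν) • fderiv ℝ (u (T + lam j ^ 2 * s / ν)) (x₀ + lam j • y)) atTop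
        (𝓝 (fderiv ℝ (v s) y)))
    (F : EuclideanSpace ℝ (Fin 3) → (EuclideanSpace ℝ (Fin 3) →L[ℝ] EuclideanSpace ℝ (Fin 3)) → ℝ)
    (hF : Continuous fun q : EuclideanSpace ℝ (Fin 3) × (EuclideanSpace ℝ (Fin 3) →L[ℝ] EuclideanSpace ℝ (Fin 3)) =>
      F q.1 q.2)
    {U : Set (EuclideanSpace ℝ (Fin 3))} (hU : IsOpen U)
    {s : ℝ} (hs : s < 0)
    (hmem : ∀ j, T + lam j ^ 2 * s / ν ∈ Set.Ico 0 T)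
    (hfadej : Tendsto (fun j => ∫⁻ y in U, ENNReal.ofReal
      |F (Real.sqrt (T - (T + lam j ^ 2 * s / ν)) • u (T + lam j ^ 2 * s / ν)
          (x₀ + Real.sqrt (T - (T + lam j ^ 2 * s / ν)) • y))
        (Real.sqrt (T - (T + lam j ^ 2 * s / ν)) ^ 2 • fderiv ℝ (u (T + lam j ^ 2 * s / ν))
          (x₀ + Real.sqrt (T - (T + lam j ^ 2 * s / ν)) • y))|) atTop (𝓝 0))
    {y : EuclideanSpace ℝ (Fin 3)} (hy : y ∈ U) :
    F ((Real.sqrt (-s) / Real.sqrt ν * ν) • v s ((Real.sqrt (-s) / Real.sqrt ν) • y))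
      (((Real.sqrt (-s) / Real.sqrt ν) ^ 2 * ν) • fderiv ℝ (v s) ((Real.sqrt (-s) / Real.sqrt ν) • y)) = 0 := by
  -- ## zoom times `tⱼ = T + λⱼ² s/ν → T⁻`
  have hns : 0 < -s := neg_pos.2 hs
  obtain ⟨t, ht⟩ : ∃ t : ℕ → ℝ, ∀ j, t j = T + lam j ^ 2 * s / ν := ⟨_, fun j => rfl⟩
  have hTt : ∀ j, T - t j = lam j ^ 2 * (-s) / ν := fun j => by rw [ht j]; ring
  have hc : ∀ j, 0 < lam j ^ 2 * (-s) / ν := fun j => div_pos (mul_pos (pow_pos (hlam j) 2) hns) hν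
  have hc0 : Tendsto (fun j => lam j ^ 2 * (-s) / ν) atTop (𝓝 0) := by
    simpa using ((hlam0.pow 2).mul_const (-s)).div_const ν
  have hfadej' : Tendsto (fun j => ∫⁻ y in U, ENNReal.ofReal
      |F (Real.sqrt (T - t j) • u (t j) (x₀ + Real.sqrt (T - t j) • y))
        (Real.sqrt (T - t j) ^ 2 • fderiv ℝ (u (t j)) (x₀ + Real.sqrt (T - t j) • y))|)
      atTop (𝓝 0) := by
    refine hfadej.congr fun j => ?_
    simp only [ht j]
  -- ## the similarity scale along the zoom: `√(T − tⱼ) = λⱼ σ`, `σ = √(−s)/√ν`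
  set σ : ℝ := Real.sqrt (-s) / Real.sqrt ν with hσ
  have hσpos : 0 < σ := div_pos (Real.sqrt_pos.2 hns) (Real.sqrt_pos.2 hν)
  have hsq : ∀ j, Real.sqrt (T - t j) = lam j * σ := by
    intro j
    rw [hTt j, hσ, Real.sqrt_div' _ hν.le, Real.sqrt_mul (pow_nonneg (hlam j).le 2),
      Real.sqrt_sq (hlam j).le]
    ring
  -- window velocity / window gradient at time `tⱼ` versus the rescaled ones at `σ y`
  set W : ℕ → EuclideanSpace ℝ (Fin 3) → EuclideanSpace ℝ (Fin 3) := fun j y =>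
    Real.sqrt (T - t j) • u (t j) (x₀ + Real.sqrt (T - t j) • y) with hWdef
  have hW : ∀ (j : ℕ) (y : EuclideanSpace ℝ (Fin 3)), W j y =
      (σ * ν) • ((lam j / ν) • u (T + lam j ^ 2 * s / ν)
        (x₀ + lam j • (σ • y))) := by
    intro j y
    simp only [hWdef, hsq j, smul_smul]
    rw [ht j]
    congr 1
    field_simp
  set G : ℕ → EuclideanSpace ℝ (Fin 3) → (EuclideanSpace ℝ (Fin 3) →L[ℝ] EuclideanSpace ℝ (Fin 3)) := fun j y =>
    Real.sqrt (T - t j) ^ 2 • fderiv ℝ (u (t j)) (x₀ + Real.sqrt (T - t j) • y) with hGdef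
  have hG : ∀ (j : ℕ) (y : EuclideanSpace ℝ (Fin 3)), G j y =
      (σ ^ 2 * ν) • ((lam j ^ 2 / ν) • fderiv ℝ (u (T + lam j ^ 2 * s / ν))
        (x₀ + lam j • (σ • y))) := by
    intro j y
    simp only [hGdef, hsq j, smul_smul]
    rw [ht j]
    congr 1
    field_simp
  -- ## the limit scalar in window coordinates and its continuity
  set Hs : EuclideanSpace ℝ (Fin 3) → ℝ := fun y =>
    F ((σ * ν) • v s (σ • y)) ((σ ^ 2 * ν) • fderiv ℝ (v s) (σ • y)) with hHsdef
  have han : AnalyticOnNhd ℝ (v s) univ := analyticOnNhd_slice hcont (bdd_of_hasTypeITimeDecay hrate) hmild hs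
  have hvs : Continuous (v s) := by
    rw [← continuousOn_univ]; exact han.continuousOn
  have hDvs : Continuous (fderiv ℝ (v s)) := (han.contDiff (n := 1)).continuous_fderiv one_ne_zero
  have hHscont : Continuous Hs := by
    show Continuous fun y => F ((σ * ν) • v s (σ • y)) ((σ ^ 2 * ν) • fderiv ℝ (v s) (σ • y))
    exact hF.comp ((((hvs.comp (continuous_const_smul σ)).const_smul (σ * ν)).prodMk
      ((hDvs.comp (continuous_const_smul σ)).const_smul (σ ^ 2 * ν))))
  have hconvW : ∀ y, Tendsto (fun j => W j y) atTop (𝓝 ((σ * ν) • v s (σ • y))) := by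
    intro y
    have h := ((hconv s hs (σ • y)).1).const_smul (σ * ν)
    exact h.congr fun j => (hW j y).symm
  have hconvG : ∀ y, Tendsto (fun j => G j y) atTop (𝓝 ((σ ^ 2 * ν) • fderiv ℝ (v s) (σ • y))) := by
    intro y
    have h := ((hconv s hs (σ • y)).2).const_smul (σ ^ 2 * ν)
    exact h.congr fun j => (hG j y).symm
  have hconvH : ∀ y, Tendsto (fun j => F (W j y) (G j y)) atTop (𝓝 (Hs y)) := fun y =>
    (hF.tendsto _).comp ((hconvW y).prodMk_nhds (hconvG y))
  -- measurability of the window scalars: `u(tⱼ)` is smooth for the shifted times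
  have hmem' : ∀ j, t j ∈ Set.Ico 0 T := fun j => by rw [ht j]; exact hmem j
  have hφ : ∀ j, Continuous fun y : EuclideanSpace ℝ (Fin 3) => x₀ + Real.sqrt (T - t j) • y :=
    fun j => continuous_const.add (continuous_const_smul _)
  have hWc : ∀ j, Continuous (W j) := fun j => by
    show Continuous fun y => Real.sqrt (T - t j) • u (t j) (x₀ + Real.sqrt (T - t j) • y)
    exact ((hcl.contDiff_velocity (hmem' j)).continuous.comp (hφ j)).const_smul (Real.sqrt (T - t j))
  have hGc : ∀ j, Continuous (G j) := fun j => by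
    show Continuous fun y =>
      Real.sqrt (T - t j) ^ 2 • fderiv ℝ (u (t j)) (x₀ + Real.sqrt (T - t j) • y)
    exact (((hcl.contDiff_velocity (hmem' j)).continuous_fderiv (by norm_cast)).comp (hφ j)).const_smul
      (Real.sqrt (T - t j) ^ 2)
  have hFjc : ∀ j, Continuous fun y => F (W j y) (G j y) := fun j => hF.comp ((hWc j).prodMk (hGc j))
  -- ## FATOU: the faded scalar vanishes on the window in the limit
  set g : EuclideanSpace ℝ (Fin 3) → ℝ≥0∞ := fun y => ENNReal.ofReal |Hs y| with hg
  have hgc : Continuous g := ENNReal.continuous_ofReal.comp (continuous_abs.comp hHscont)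
  have hgjm : ∀ j, Measurable fun y => ENNReal.ofReal |F (W j y) (G j y)| :=
    fun j => (ENNReal.continuous_ofReal.comp (continuous_abs.comp (hFjc j))).measurable
  have hptw : ∀ y, Tendsto (fun j => ENNReal.ofReal |F (W j y) (G j y)|) atTop (𝓝 (g y)) :=
    fun y => ENNReal.tendsto_ofReal ((continuous_abs.tendsto (Hs y)).comp (hconvH y))
  have hFatou : ∫⁻ y in U, liminf (fun j => ENNReal.ofReal |F (W j y) (G j y)|) atTop ≤
      liminf (fun j => ∫⁻ y in U, ENNReal.ofReal |F (W j y) (G j y)|) atTop :=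
    lintegral_liminf_le' (fun j => (hgjm j).aemeasurable)
  have hlim : (fun y => liminf (fun j => ENNReal.ofReal |F (W j y) (G j y)|) atTop) = g :=
    funext fun y => (hptw y).liminf_eq
  have hfadeW : Tendsto (fun j => ∫⁻ y in U, ENNReal.ofReal |F (W j y) (G j y)|) atTop (𝓝 0) := hfadej'
  rw [hlim, hfadeW.liminf_eq] at hFatou
  have hint : ∫⁻ y in U, g y = 0 := le_antisymm hFatou bot_le
  have hae : ∀ᵐ y ∂(volume.restrict U), g y = 0 := (lintegral_eq_zero_iff hgc.measurable).1 hint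
  rw [ae_restrict_iff' hU.measurableSet] at hae
  have hzero : ∀ y ∈ U, g y = 0 := by
    intro y hy
    by_contra hne
    set O : Set (EuclideanSpace ℝ (Fin 3)) := U ∩ g ⁻¹' (Ioi 0) with hO
    have hOo : IsOpen O := hU.inter (isOpen_Ioi.preimage hgc)
    have hO0 : volume O = 0 := by
      rw [measure_eq_zero_iff_ae_notMem]
      filter_upwards [hae] with y' hy'
      rintro ⟨h1, h2⟩
      have := hy' h1
      simp only [mem_preimage, mem_Ioi, this, lt_self_iff_false] at h2
    have hOe : O = ∅ := (hOo.measure_eq_zero_iff volume).1 hO0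
    have hyO : y ∈ O := ⟨hy, by simpa [mem_preimage, mem_Ioi, pos_iff_ne_zero] using hne⟩
    rw [hOe] at hyO
    exact hyO
  have h := hzero y hy
  simp only [hg, ENNReal.ofReal_eq_zero] at h
  exact abs_eq_zero.1 (le_antisymm h (abs_nonneg _))


end Summit.NavierStokesRegularity.NavierStokesRegularity.Theorems.LocalSineTubeDoorWindowFatouSeq

end
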